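import Literature.AlgebraicGeometry.AbelianSchemes.LevelSectionsSubgroup
import Literature.AlgebraicGeometry.AbelianSchemes.LevelStructureOfIsogeny
import HarnessLib

/-!
# The image of a constant torsion subgroup under a homomorphism consists of constant sections of the induced level structure

Layer `Literature/AlgebraicGeometry/AbelianSchemes`, namespace `Literature.AlgebraicGeometry.AbelianSchemes.AbelianSchemeOver.LevelStructure`.
THEOREMS ONLY (no definition, no named fact, no instance, no `sorry`).

[MumfordFogartyKirwan1994, Ch. 7 §2 Def. 7.1 (p. 129), App. 7A (p. 235)]: a level-`N` structure `φ = (σᵢ)` on `A/S` gives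
the level-`n` structure `φ.changeLevel n d = (σᵢ^d)` for `N = n · d` (★ `LevelStructureChangeLevel`), and along a homomorphism
`u : A → B` the family `(σᵢ^d ≫ u)` may again be a level-`n` structure `χ` on `B` (★ `LevelStructureOfIsogeny`, ★ (u5)
`exists_hatLevelStructure_of_locallyOfFiniteType` for `u = λ` a polarisation of degree prime to `n`).  For the constant subgroup
`K = φ(K₀) ≤ A(S)` indexed by an `n`-TORSION index set `K₀ ⊆ (ℤ/N)^{2g}` (★ `LevelSectionsSubgroup`, shape
`σ ∈ K ↔ ∃ c ∈ K₀, φ(c) = σ`, `n • K₀ = 0`), the image `u_*K ≤ B(S)` consists of constant sections of `χ`: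
**`map_subset_range_section_of_changeLevel`** — `u_*K ⊆ χ((ℤ/n)^{2g})`.  Elementary: `c ∈ K₀` with `n • c = 0` is
`d • c₁`, `φ(c) = φ(c₁)^d = (σ^d)(c̄₁)` (★ `sectionPow_natCast_smul`, ★ `sectionPow_eq_prod`), and `χ(c̄₁) = (σ^d)(c̄₁) ≫ u` (★
`section_of_σ_comp`).

Cell `hodgecm-mathlib` (D-0151), HECKE-LINK socket (B) / D6 `h4` package: this is the binder `hK'φ` of the (K) closer ★-to-be
`PoincarePullbackStabilizerOfLevel.hStab_of_level_of_count` at `K′ := λ′_*K` (B-p08 (g10) 00:25:19Z spelling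
`K.map (IsMonHom.monoidHom λ′ (𝟙_ (Over S)))`), `φ := P′.level`, `χ :=` the hat level structure.  Count-neutral; HC_CM is proved
only modulo the 7 printed citations until rung 0 closes.

## References
* [MumfordFogartyKirwan1994] D. Mumford, J. Fogarty, F. Kirwan, *Geometric Invariant Theory*, 3rd ed. (1994), Ch. 7 §2
  Definition 7.1 (p. 129) and App. 7A (p. 235).
* [MumfordAV1970] D. Mumford, *Abelian Varieties* (1970), §7 Thm. 4 (p. 72).
-/

set_option autoImplicit false

noncomputable section

universe u

open CategoryTheory CategoryTheory.Limits AlgebraicGeometry MonoidalCategory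
open scoped MonObj

namespace Literature.AlgebraicGeometry.AbelianSchemes

namespace AbelianSchemeOver

namespace LevelStructure

variable {S : Scheme.{u}} {A B : AbelianSchemeOver S} {g N : ℕ}

/-- **An `n`-torsion exponent vector mod `N = n · d` is `d` times a vector**: if `(n : ℤ/N) • c = 0` then
`c = (d : ℤ/N) • c₁` with `c₁ᵢ := ⌊cᵢ/d⌋` and `⌊cᵢ/d⌋ < n`. [cite: MumfordFogartyKirwan1994, App. 7A (p. 235)] -/
theorem exists_eq_natCast_smul_of_natCast_smul_eq_zero {J : Type*} {n d : ℕ} (hd : N = n * d) (hN : N ≠ 0)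
    (c : J → ZMod N) (hc : (n : ZMod N) • c = 0) :
    ∀ i, d ∣ (c i).val ∧ (c i).val / d < n ∧ ((((c i).val / d : ℕ) : ZMod N)) * (d : ZMod N) = c i := by
  haveI : NeZero N := ⟨hN⟩
  have hn0 : 0 < n := Nat.pos_of_ne_zero (by rintro rfl; exact hN (by rw [hd, zero_mul]))
  intro i
  have hi : (n : ZMod N) * c i = 0 := by
    have := congr_fun hc i
    simpa only [Pi.smul_apply, smul_eq_mul, Pi.zero_apply] using this
  have hdvd : d ∣ (c i).val := by
    rw [← ZMod.natCast_zmod_val (c i), ← Nat.cast_mul, ZMod.natCast_eq_zero_iff] at hi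
    have hi' : n * d ∣ n * (c i).val := hd ▸ hi
    exact Nat.dvd_of_mul_dvd_mul_left hn0 hi'
  refine ⟨hdvd, ?_, ?_⟩
  · exact Nat.div_lt_of_lt_mul (by rw [Nat.mul_comm, ← hd]; exact ZMod.val_lt (c i))
  · rw [← Nat.cast_mul, Nat.div_mul_cancel hdvd, ZMod.natCast_zmod_val]

/-- **`u_*K ⊆ χ((ℤ/n)^{2g})`** — the image under a homomorphism `u : A → B` of the constant subgroup `K = φ(K₀)` of an
`n`-torsion index set `K₀ ⊆ (ℤ/N)^{2g}` (`N = n · d`) consists of constant sections of any level-`n` structure `χ` on `B` with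
`χᵢ = σᵢ^d ≫ u`.  This is the binder `hK'φ` of the (K) closer at `K′ := u_*K`.
[cite: MumfordFogartyKirwan1994, Ch. 7 §2 Definition 7.1 (p. 129) and App. 7A (p. 235)] [cite: MumfordAV1970, §7 Thm. 4 (p. 72)] -/
theorem map_subset_range_section_of_changeLevel [IsCommMonObj A.X] (φ : A.LevelStructure g N) (u : A.X ⟶ B.X)
    [IsMonHom u] {n d : ℕ} (hd : N = n * d) (hN : N ≠ 0) (χ : B.LevelStructure g n)
    (hχ : ∀ i, χ.σ i = (φ.changeLevel n d hd hN).σ i ≫ u) {K₀ : Set (Fin g ⊕ Fin g → ZMod N)}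
    {K : Subgroup A.Sections} (hK : ∀ σ : A.Sections, σ ∈ K ↔ ∃ c ∈ K₀, φ.section_ c = σ)
    (hm : ∀ c ∈ K₀, (n : ZMod N) • c = 0) :
    (K.map (IsMonHom.monoidHom u (𝟙_ (Over S))) : Set B.Sections) ⊆ Set.range χ.section_ := by
  classical
  haveI : NeZero N := ⟨hN⟩
  haveI : NeZero n := ⟨by rintro rfl; exact hN (by rw [hd, zero_mul])⟩
  rintro _ ⟨σ, hσ, rfl⟩
  obtain ⟨c, hc, rfl⟩ := (hK σ).1 hσ
  have hdec := exists_eq_natCast_smul_of_natCast_smul_eq_zero hd hN c (hm c hc)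
  -- the exponent vector `c₁ = c/d`, read mod `N` and mod `n`
  let c₁ : Fin g ⊕ Fin g → ZMod N := fun i => (((c i).val / d : ℕ) : ZMod N)
  let a : Fin g ⊕ Fin g → ZMod n := fun i => (((c i).val / d : ℕ) : ZMod n)
  have hc₁ : ((d : ℕ) : ZMod N) • c₁ = c := by
    funext i
    rw [Pi.smul_apply, smul_eq_mul, mul_comm]
    exact (hdec i).2.2
  refine ⟨a, ?_⟩
  -- `χ(a) = (σ^d)(a) ≫ u` and `(σ^d)(a) = φ(c₁)^d = φ(d • c₁) = φ(c)`
  rw [section_of_σ_comp hχ a]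
  change (φ.changeLevel n d hd hN).section_ a ≫ u = φ.section_ c ≫ u
  congr 1
  rw [← hc₁]
  change A.sectionPow (fun i => φ.σ i ^ d) a = A.sectionPow φ.σ (((d : ℕ) : ZMod N) • c₁)
  rw [A.sectionPow_natCast_smul φ.pow_σ d c₁, A.sectionPow_eq_prod, A.sectionPow_eq_prod, ← Finset.prod_pow]
  refine Finset.prod_congr rfl fun k _ => ?_
  rw [← pow_mul, ← pow_mul, Nat.mul_comm]
  congr 2
  -- `(a k).val = (c k).val / d = (c₁ k).val`
  change (((c k).val / d : ℕ) : ZMod n).val = ((((c k).val / d : ℕ) : ZMod N)).val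
  rw [ZMod.val_natCast, ZMod.val_natCast, Nat.mod_eq_of_lt (hdec k).2.1,
    Nat.mod_eq_of_lt (lt_of_le_of_lt (Nat.div_le_self _ _) (ZMod.val_lt (c k)))]

end LevelStructure

end AbelianSchemeOver

end Literature.AlgebraicGeometry.AbelianSchemes

end
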